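import Literature.MathematicalPhysics.QuantumFieldTheory.Balaban1983to89.T4RunLadder
import Literature.MathematicalPhysics.QuantumFieldTheory.Balaban1983to89.T4EffectiveLawLimit
import Literature.MathematicalPhysics.QuantumFieldTheory.Balaban1983to89.T4ContinuumLaw

/-!
# RUNG (B)+1 BOOKKEEPING: NODE U5's ACTION-LEVEL TWO-RUN INPUT NE7-A / NE7-A′ STATED ALONG THE CANONICAL UNIT
# FACTORISATION — the hypothesis shapes `UnitFactorisation.EffTiltRate` / `EffTiltRateGB` of `T4VarianceMatching` §8
# with the interface datum SUPPLIED by the kernel (`T4RunLadder.unitFactorisation`), and their reductions to the apex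
# `Missing.HasContinuumLimit`, to the carved hybrid NE7 `T4CauchySum.MatchingModConstants` and to node U0's
# `T4Assembly.GenFunCauchy` restated for the data's own scheme `D.scheme g₀`
# (cell `pub-balaban`, scoping sub-cell `t4`, lineage `b2b-balaban-t4-ne7-p3` (node U5 / NE7, fan-out prover seat P3
# "variance / second-moment route"), gen 4; journal row T4-U5.NE7-PROVE-P3*; LEAF: imports `T4RunLadder` only;
# ADDITIVE — no existing module is modified)

HONEST FRAMING.  Rung (B)+1 = the `ε → 0` limit of the joint expectations of unit-scale averaged gauge-invariant loop
variables on ONE four-torus, a scoping target carried with (B) = [Balaban1989LargeFieldII] Thm 1 and a β-function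
hypothesis inside every downstream target (never discharged).  NOT infinite volume, NOT a mass gap, NOT the Clay
problem, NOT summit progress.  This file is BOOKKEEPING.  Every declaration is [folklore]: NO sentence of Bałaban's
series is quoted here, NO printed estimate, bound or convergence statement is asserted, and the analytic content —
the two-run input NE7-A (`CanonicalEffTiltRate`) resp. NE7-A′ (`CanonicalEffTiltRateGB`) with SUMMABLE rates — stays an
explicit hypothesis of every theorem.  That input is NOT PRINTED: Bałaban's papers never compare two runs with different
bare couplings / depths (the small-field effective actions of [B12] Thm 3 / [B13] exist per run; [B16] p. 356 defers the
continuum limit of expectations to a paper that did not appear) — cell records GAPS G-ne7p3-7 (+ UPDATE v7), T4-REF-U5 F2,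
C-ne7p3-6; see the certified header of `T4VarianceMatching` (§8, §9) for the located print and located absence.

## Why

`T4VarianceMatching` §8–§9 types node U5's missing two-run inequality at the most upstream layer that is printed per run —
the unit-lattice EFFECTIVE ACTION — over an INTERFACE `F : UnitFactorisation S X` (one measurable space `X` through which
all observables of all runs factor), and proves in the kernel `F.EffTiltRate R σ ∧ Σσ < ∞ ⇒ HasContinuumLimit S`,
`⇒ T4CauchySum.MatchingModConstants 1 l₀ δ (T4GenFunBounds.schemeZ S os)` (every string, every radius) and
`⇒ T4Assembly.GenFunCauchy S l₀` (and the same from the good/bad form `EffTiltRateGB`).  `T4RunLadder` §3 (t4-lean lineage)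
INHABITS that interface for the cell's data type: for every finite-`ε` datum `D : FiniteEpsData F G` with measurable
averagings (`D.AvgMeasurable` — a theorem for (0.4)/(0.12)-block-averaged data) the canonical factorisation
`T4RunLadder.unitFactorisation D hM g₀` of the scheme `D.scheme g₀` has `X` = configurations of the unit lattice
`Site (F.P 0) 0`, `A_K = unitShift K ∘ avg_{K-1} ∘ ⋯ ∘ avg_0`, `W_C = loopAt · (C.atLevel 0)`.  This file composes the two:
the located gap of node U5 in its action-level form becomes a statement about the DATA ALONE — the push-forwards of the
Wilson Gibbs measures `gibbsMeasure (F.P K) (g₀ K)⁻²` under `K` averaging steps read on the unit lattice (`effLaw K`, the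
law entering every unit-scale averaged expectation by `UnitFactorisation.expectAt_eq_integral_effLaw`) of CONSECUTIVE runs
are mutual Gibbs tilts with a `K`-uniform range bound and summable mean oscillation — with no interface datum left for a
supplier, exactly as `T4RunLadder.CanonicalGoodBadRate` did for the relocation lane.

## What this file adds (and only this)

§1 `scheme_β_nonneg` (`β_K = (g₀ K)⁻² ≥ 0`, `FiniteEpsData.scheme_β_eq`), `scheme_obs_measurable` (from `AvgMeasurable`, `FiniteEpsData.measurable_avgObs`):
   the two side conditions of the §8/§9 theorems DISCHARGED for `D.scheme g₀`.
§2 **`CanonicalEffTiltRate D hM g₀ R σ := (unitFactorisation D hM g₀).EffTiltRate R σ`** (hypothesis shape, NOT PRINTED)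
   with its unfolding `canonicalEffTiltRate_iff` (`Iff.rfl`), and `hasContinuumLimit_of_canonicalEffTiltRate` (Σσ < ∞ ⇒
   apex), `expectCauchyRate_of_canonicalEffTiltRate` (δ_K = 2e^{2R}σ_K), `matchingModConstants_of_canonicalEffTiltRate`
   (the carved NE7 with `vol = 1`, δ_K = e^{4R+2l₀}σ_K, every string `Cs`, every `l₀ ≥ 0`),
   `genFunCauchy_of_canonicalEffTiltRate` (node U0's input).
§3 the same for the good/bad form: **`CanonicalEffTiltRateGB D hM g₀ R σ w w'`**, `hasContinuumLimit_of_canonicalEffTiltRateGB`,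
   `expectCauchyRate_of_canonicalEffTiltRateGB`, `matchingModConstants_of_canonicalEffTiltRateGB` (needs `w' ≤ ½`),
   `genFunCauchy_of_canonicalEffTiltRateGB`.
§4 (0.4)- and (0.12)-BLOCK-AVERAGED DATA over a `RegularGaugeGroup` with measurable averages: measurability from the kernel
   (`avgMeasurable_of_blockAvg(₂)`), so the ONLY hypothesis left is the analytic one —
   `hasContinuumLimit_of_blockAvg_effTiltRate(GB)`, `hasContinuumLimit_of_blockAvg₂_effTiltRate(GB)`.
§5 (appendix) the law-level currencies of `T4VarianceMatching` §4–§6 along the same factorisation, each `⇒` apex for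
   `D.scheme g₀` with the side conditions discharged (`scheme_abs_obs_le_one` from `FiniteEpsData.abs_avgObs_le_one`):
   `hasContinuumLimit_of_canonicalEffTransportRate`, `…EffDensityRate`, `…EffSecondMomentRate`.
§6 (v2) the WEAKEST canonical density-level currency **`CanonicalDensityChain D hM g₀ δ :=
   T4EffectiveLawLimit.DensityChain (unitFactorisation D hM g₀).effLaw δ`** (hypothesis shape, NOT PRINTED; producers:
   `canonicalDensityChain_of_canonicalEffTiltRate(GB)`, `…_of_effDensityRate`) and, under `Σ δ_K < ∞`, THE LIMITING
   EFFECTIVE UNIT-LATTICE LAW OF THE DATA (`exists_limitLaw_of_canonicalDensityChain`: a probability law `ν ≪ effLaw 0` on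
   unit-lattice gauge fields, total-variation limit of the `effLaw K` at the tail rate), the continuum limit of every string
   identified as `∫ ∏ W_C dν` (`exists_limitLaw_tendsto_expectAt_of_canonicalDensityChain`), the apex, the carved NE7 with
   remainder `e^{2l₀} δ_K` and constants `log Z_{K+1}(0) − log Z_K(0)` (`matchingModConstants_of_canonicalDensityChain`),
   `genFunCauchy_of_canonicalDensityChain`, T4LimitLaw's unique limit law identified as `(wVec)_* ν`
   (`exists_limitLaw_identified_of_canonicalDensityChain`), the (0.12)-block-averaged corollary, and the same four
   consequences (limiting law with `ν ≪ Σ 2^{-(K+1)} effLaw_K`, identified string limits, carved NE7 with remainder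
   `e^{2l₀}·2t_K`, `GenFunCauchy`) from the WEAKEST law-level currency, pv01's NE7-TV `T4MaximalCoupling.EffTVRate`
   along the canonical factorisation (`…_of_canonicalEffTVRate`).
§7 (v2; `T4ContinuumLaw` imported for it) THE CONTINUUM LAW IDENTIFIED: for ANY probability law `ν` on unit-lattice fields
   with tail bounds `|∫ g d(effLaw K) − ∫ g dν| ≤ B·a_K`, `a_K → 0`, `T4ContinuumLaw.continuumLaw S … = (wVec)_* ν`
   (scheme level, `continuumLaw_eq_map_of_tail`), `apexContinuumLaw D hM g₀ h = (wVec)_* ν` and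
   `IsContinuumLawAt D hM g₀ ((wVec)_* ν)` (`apexContinuumLaw_eq_map_of_tail`, `isContinuumLawAt_map_of_tail`); hence
   under a summable canonical density chain / canonical NE7-TV / canonical NE7-A THE CONTINUUM LAW OF THE DATA — the law
   on the loop cube on which `T4ContinuumLaw`'s uniqueness, symmetry and OS / Hilbert-space statements are built — is the
   image under the averaged loop variables of a probability law on unit-lattice gauge fields (`ν ≪ effLaw 0`, resp.
   `≪` the dominating mixture), with its tail bounds (`exists_limitLaw_isContinuumLawAt_of_canonicalDensityChain /
   _of_canonicalEffTVRate / _of_canonicalEffTiltRate`; scheme level `exists_limitLaw_continuumLaw_eq_of_densityChain /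
   _of_effTVRate`).

WHAT IS NOT PROVED / VALUE.  Nothing analytic.  `CanonicalEffTiltRate(GB)` with summable rates for Bałaban's densities is
the located gap G-ne7p3-7 itself (a DIFFERENCE statement about two runs' small-field effective actions plus single-run
large-field weights); it is not printed and not proved anywhere.  VALUE = the action-level member of node U5 now reads,
in the kernel and by name, as a property of the cell's finite-`ε` data with no supplier interface, feeding the apex, the
carved NE7 and node U0.  NOT summit progress.

Upstream: `T4RunLadder`, `T4ContinuumLaw` (v2, §7 only; hence `T4ApexHybrid`, `T4LimitLawOSHilbert`), `T4EffectiveLawLimit` (v2; hence `T4LevelShift`, `T4ObservableTelescopeTwoRun`, `T4VarianceMatching`, `T4CauchySum`,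
`T4Assembly`, `T4GenFunBounds`, `T4Continuum`, `BlockAveraging(TwoLevel)`, …).  Consumers: none yet (the t4-carver's
NE7 census; the NE7 lineage's record `t4/T4-EST-NE7-P3.md`).
-/

noncomputable section

namespace Literature.MathematicalPhysics.QuantumFieldTheory.Balaban1983to89.T4CanonicalTiltRate

open MeasureTheory T4Continuum T4LevelShift T4RunLadder Missing T4CauchySum T4VarianceMatching

variable {F : T4Family} {G : Type*} [GaugeGroup G] [MeasurableSpace G] [HaarData G]

/-! ## §1 The side conditions of `T4VarianceMatching` §8/§9 for the data's scheme -/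

/-- `β_K = (g₀ K)⁻² ≥ 0` for the data's scheme (`FiniteEpsData.scheme_β_eq`). [folklore] -/
theorem scheme_β_nonneg (D : FiniteEpsData F G) (g₀ : ℕ → ℝ) : ∀ K, 0 ≤ (D.scheme g₀).β K :=
  fun K => (D.scheme_β_eq g₀ K).2

/-- The scheme's observables (averaged loop variables) are measurable, given `AvgMeasurable`. [folklore] -/
theorem scheme_obs_measurable [RegularGaugeGroup G] (D : FiniteEpsData F G) (hM : D.AvgMeasurable) (g₀ : ℕ → ℝ) :
    ∀ K C, Measurable ((D.scheme g₀).obs K C) :=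
  fun K C => D.measurable_avgObs hM K C

variable [RegularGaugeGroup G]

/-- The canonical effective unit-lattice law of run `K`: the push-forward of the Wilson Gibbs measure at `β_K = (g₀ K)⁻²`
under `K` averaging steps read on the unit lattice. [folklore] -/
theorem effLaw_unitFactorisation (D : FiniteEpsData F G) (hM : D.AvgMeasurable) (g₀ : ℕ → ℝ) (K : ℕ) :
    (unitFactorisation D hM g₀).effLaw K =
      Measure.map (fun U => unitShift K (Averaging.iter (D.av K) K U))
        (T4GenFunBounds.gibbsMeasure (F.P K) ((g₀ K)⁻¹ ^ 2)) :=
  rfl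

/-! ## §2 NE7-A along the canonical unit factorisation -/

/-- **NE7-A FOR THE DATA (hypothesis shape, NOT PRINTED)**: `UnitFactorisation.EffTiltRate` of `T4VarianceMatching` §8
along the canonical unit factorisation `T4RunLadder.unitFactorisation D hM g₀` — for every `K` the canonical effective
unit-lattice law of run `K+1` is the Gibbs tilt of that of run `K` by a measurable relative action `f_K` with `|f_K| ≤ R`
and `∫ |f_K − κ_K| d(effLaw K) ≤ σ_K`.  The missing inequality of node U5 in this currency is `Σ_K σ_K < ∞` for
Bałaban's block-averaged data (GAPS G-ne7p3-7); no printed theorem supplies it. [folklore] -/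
def CanonicalEffTiltRate (D : FiniteEpsData F G) (hM : D.AvgMeasurable) (g₀ : ℕ → ℝ) (R : ℝ) (σ : ℕ → ℝ) : Prop :=
  (unitFactorisation D hM g₀).EffTiltRate R σ

/-- The shape unfolded: a statement about the data's push-forward laws alone. [folklore] -/
theorem canonicalEffTiltRate_iff (D : FiniteEpsData F G) (hM : D.AvgMeasurable) (g₀ : ℕ → ℝ) (R : ℝ) (σ : ℕ → ℝ) :
    CanonicalEffTiltRate D hM g₀ R σ ↔
      ∀ K : ℕ, ∃ (f : GaugeField (F.P 0) 0 G → ℝ) (κ : ℝ), Measurable f ∧ (∀ u, |f u| ≤ R) ∧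
        (unitFactorisation D hM g₀).effLaw (K + 1) = ((unitFactorisation D hM g₀).effLaw K).tilted f ∧
        ∫ u, |f u - κ| ∂((unitFactorisation D hM g₀).effLaw K) ≤ σ K :=
  Iff.rfl

/-- **NE7-A for the data with `Σσ < ∞` ⇒ the rung-(B)+1 apex** for the data's scheme. [folklore] -/
theorem hasContinuumLimit_of_canonicalEffTiltRate (D : FiniteEpsData F G) (hM : D.AvgMeasurable) (g₀ : ℕ → ℝ)
    {R : ℝ} {σ : ℕ → ℝ} (hσ : Summable σ) (h : CanonicalEffTiltRate D hM g₀ R σ) : HasContinuumLimit (D.scheme g₀) :=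
  (unitFactorisation D hM g₀).hasContinuumLimit_of_effTiltRate (scheme_β_nonneg D g₀) (scheme_obs_measurable D hM g₀) hσ h

/-- NE7-A for the data ⇒ the observable Cauchy rate `δ_K = 2e^{2R}σ_K`, constant `1`, every string. [folklore] -/
theorem expectCauchyRate_of_canonicalEffTiltRate (D : FiniteEpsData F G) (hM : D.AvgMeasurable) (g₀ : ℕ → ℝ)
    {R : ℝ} {σ : ℕ → ℝ} (h : CanonicalEffTiltRate D hM g₀ R σ) :
    ExpectCauchyRate (D.scheme g₀) (fun K => 2 * Real.exp (2 * R) * σ K) :=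
  (unitFactorisation D hM g₀).expectCauchyRate_of_effTiltRate (scheme_β_nonneg D g₀) (scheme_obs_measurable D hM g₀) h

/-- **NE7-A for the data ⇒ THE CARVED HYBRID NE7** `T4CauchySum.MatchingModConstants 1 l₀ δ (schemeZ (D.scheme g₀) Cs)` for
every string `Cs` and every `l₀ ≥ 0`, with `δ_K = e^{4R+2l₀}σ_K` (`T4VarianceMatching` §9). [folklore] -/
theorem matchingModConstants_of_canonicalEffTiltRate (D : FiniteEpsData F G) (hM : D.AvgMeasurable) (g₀ : ℕ → ℝ)
    {R : ℝ} {σ : ℕ → ℝ} (h : CanonicalEffTiltRate D hM g₀ R σ) {l₀ : ℝ} (hl₀ : 0 ≤ l₀) (Cs : List (ULoop F)) :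
    T4CauchySum.MatchingModConstants 1 l₀ (fun K => Real.exp (4 * R + 2 * l₀) * σ K)
      (T4GenFunBounds.schemeZ (D.scheme g₀) Cs) :=
  (unitFactorisation D hM g₀).matchingModConstants_of_effTiltRate (scheme_β_nonneg D g₀)
    (scheme_obs_measurable D hM g₀) h hl₀ Cs

/-- **NE7-A for the data with `Σσ < ∞` ⇒ node U0's input `T4Assembly.GenFunCauchy (D.scheme g₀) l₀`** for every `l₀ ≥ 0`.
[folklore] -/
theorem genFunCauchy_of_canonicalEffTiltRate (D : FiniteEpsData F G) (hM : D.AvgMeasurable) (g₀ : ℕ → ℝ)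
    {R : ℝ} {σ : ℕ → ℝ} (hσ : Summable σ) (h : CanonicalEffTiltRate D hM g₀ R σ) {l₀ : ℝ} (hl₀ : 0 ≤ l₀) :
    T4Assembly.GenFunCauchy (D.scheme g₀) l₀ :=
  (unitFactorisation D hM g₀).genFunCauchy_of_effTiltRate (scheme_β_nonneg D g₀) (scheme_obs_measurable D hM g₀)
    hσ h hl₀

/-! ## §3 NE7-A′ (good/bad form) along the canonical unit factorisation -/

/-- **NE7-A′ FOR THE DATA (hypothesis shape, NOT PRINTED)**: `UnitFactorisation.EffTiltRateGB` of `T4VarianceMatching` §8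
along the canonical unit factorisation — `effLaw (K+1) = g_K · effLaw K` with `g_K = C_K e^{h_K}`, `|h_K| ≤ R` on a good set
`Gd_K` where `∫_{Gd_K} |h_K| ≤ σ_K`, and single-run large-field weights `effLaw K (Gd_Kᶜ) ≤ w_K ≤ ½`,
`∫_{Gd_Kᶜ} g_K d(effLaw K) ≤ w'_K`.  Missing inequality: `Σ_K (σ_K + w_K + w'_K) < ∞` for Bałaban's data (GAPS G-ne7p3-7).
[folklore] -/
def CanonicalEffTiltRateGB (D : FiniteEpsData F G) (hM : D.AvgMeasurable) (g₀ : ℕ → ℝ) (R : ℝ) (σ w w' : ℕ → ℝ) :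
    Prop :=
  (unitFactorisation D hM g₀).EffTiltRateGB R σ w w'

/-- **NE7-A′ for the data with summable rates ⇒ the rung-(B)+1 apex.** [folklore] -/
theorem hasContinuumLimit_of_canonicalEffTiltRateGB (D : FiniteEpsData F G) (hM : D.AvgMeasurable) (g₀ : ℕ → ℝ)
    {R : ℝ} {σ w w' : ℕ → ℝ} (hσ : Summable σ) (hw : Summable w) (hw' : Summable w')
    (h : CanonicalEffTiltRateGB D hM g₀ R σ w w') : HasContinuumLimit (D.scheme g₀) :=
  (unitFactorisation D hM g₀).hasContinuumLimit_of_effTiltRateGB (scheme_β_nonneg D g₀) (scheme_obs_measurable D hM g₀)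
    hσ hw hw' h

/-- NE7-A′ for the data ⇒ the observable Cauchy rate `δ_K = 4e^{2R}σ_K + 2(w_K + w'_K)`. [folklore] -/
theorem expectCauchyRate_of_canonicalEffTiltRateGB (D : FiniteEpsData F G) (hM : D.AvgMeasurable) (g₀ : ℕ → ℝ)
    {R : ℝ} {σ w w' : ℕ → ℝ} (h : CanonicalEffTiltRateGB D hM g₀ R σ w w') :
    ExpectCauchyRate (D.scheme g₀) (fun K => 4 * Real.exp (2 * R) * σ K + 2 * (w K + w' K)) :=
  (unitFactorisation D hM g₀).expectCauchyRate_of_effTiltRateGB (scheme_β_nonneg D g₀) (scheme_obs_measurable D hM g₀) h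

/-- **NE7-A′ for the data ⇒ THE CARVED HYBRID NE7** with `δ_K = 4e^{4l₀+2R}(σ_K + w_K + w'_K)` (needs `w'_K ≤ ½`, which pins the
normalisation `C_K ≥ e^{-R}/2`). [folklore] -/
theorem matchingModConstants_of_canonicalEffTiltRateGB (D : FiniteEpsData F G) (hM : D.AvgMeasurable) (g₀ : ℕ → ℝ)
    {R : ℝ} {σ w w' : ℕ → ℝ} (h : CanonicalEffTiltRateGB D hM g₀ R σ w w') (hw'2 : ∀ K, w' K ≤ 1 / 2) {l₀ : ℝ}
    (hl₀ : 0 ≤ l₀) (Cs : List (ULoop F)) :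
    T4CauchySum.MatchingModConstants 1 l₀ (fun K => 4 * Real.exp (4 * l₀ + 2 * R) * (σ K + w K + w' K))
      (T4GenFunBounds.schemeZ (D.scheme g₀) Cs) :=
  (unitFactorisation D hM g₀).matchingModConstants_of_effTiltRateGB (scheme_β_nonneg D g₀)
    (scheme_obs_measurable D hM g₀) h hw'2 hl₀ Cs

/-- **NE7-A′ for the data with summable rates ⇒ node U0's input `T4Assembly.GenFunCauchy (D.scheme g₀) l₀`.** [folklore] -/
theorem genFunCauchy_of_canonicalEffTiltRateGB (D : FiniteEpsData F G) (hM : D.AvgMeasurable) (g₀ : ℕ → ℝ)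
    {R : ℝ} {σ w w' : ℕ → ℝ} (hσ : Summable σ) (hws : Summable w) (hw's : Summable w')
    (h : CanonicalEffTiltRateGB D hM g₀ R σ w w') (hw'2 : ∀ K, w' K ≤ 1 / 2) {l₀ : ℝ} (hl₀ : 0 ≤ l₀) :
    T4Assembly.GenFunCauchy (D.scheme g₀) l₀ :=
  (unitFactorisation D hM g₀).genFunCauchy_of_effTiltRateGB (scheme_β_nonneg D g₀) (scheme_obs_measurable D hM g₀)
    hσ hws hw's h hw'2 hl₀

/-! ## §4 Block-averaged data: measurability from the kernel, only the analytic hypothesis left -/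

/-- **EXISTENCE FOR A (0.4)-BLOCK-AVERAGED DATUM from NE7-A** (measurable small-loop average `ℰ`; measurability of the
averagings by `avgMeasurable_of_blockAvg`): the only hypothesis left is NE7-A with `Σσ < ∞` — NOT PRINTED. [folklore] -/
theorem hasContinuumLimit_of_blockAvg_effTiltRate (D : FiniteEpsData F G) (ℰ : LoopAverage G)
    (hE : ∀ n, Measurable (fun W : Fin (n+1) → G => ℰ.E W)) (hD : ∀ K j, D.av K j = BlockAveraging.blockAvg ℰ)
    (g₀ : ℕ → ℝ) {R : ℝ} {σ : ℕ → ℝ} (hσ : Summable σ)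
    (h : CanonicalEffTiltRate D (D.avgMeasurable_of_blockAvg ℰ hE hD) g₀ R σ) : HasContinuumLimit (D.scheme g₀) :=
  hasContinuumLimit_of_canonicalEffTiltRate D _ g₀ hσ h

/-- **EXISTENCE FOR A (0.4)-BLOCK-AVERAGED DATUM from NE7-A′.** [folklore] -/
theorem hasContinuumLimit_of_blockAvg_effTiltRateGB (D : FiniteEpsData F G) (ℰ : LoopAverage G)
    (hE : ∀ n, Measurable (fun W : Fin (n+1) → G => ℰ.E W)) (hD : ∀ K j, D.av K j = BlockAveraging.blockAvg ℰ)
    (g₀ : ℕ → ℝ) {R : ℝ} {σ w w' : ℕ → ℝ} (hσ : Summable σ) (hw : Summable w) (hw' : Summable w')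
    (h : CanonicalEffTiltRateGB D (D.avgMeasurable_of_blockAvg ℰ hE hD) g₀ R σ w w') : HasContinuumLimit (D.scheme g₀) :=
  hasContinuumLimit_of_canonicalEffTiltRateGB D _ g₀ hσ hw hw' h

/-- **EXISTENCE FOR A (0.12)-BLOCK-AVERAGED DATUM from NE7-A** (measurable `𝓜`, `ℰ`; `avgMeasurable_of_blockAvg₂`). [folklore] -/
theorem hasContinuumLimit_of_blockAvg₂_effTiltRate (D : FiniteEpsData F G) (𝓜 : GroupAverage G) (ℰ : LoopAverage G)
    (hMm : ∀ n, Measurable (fun W : Fin (n+1) → G => 𝓜.M W)) (hE : ∀ n, Measurable (fun W : Fin (n+1) → G => ℰ.E W))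
    (hD : ∀ K j, D.av K j = BlockAveragingTwoLevel.blockAvg₂ 𝓜 ℰ) (g₀ : ℕ → ℝ) {R : ℝ} {σ : ℕ → ℝ} (hσ : Summable σ)
    (h : CanonicalEffTiltRate D (D.avgMeasurable_of_blockAvg₂ 𝓜 ℰ hMm hE hD) g₀ R σ) : HasContinuumLimit (D.scheme g₀) :=
  hasContinuumLimit_of_canonicalEffTiltRate D _ g₀ hσ h

/-- **EXISTENCE FOR A (0.12)-BLOCK-AVERAGED DATUM from NE7-A′.** [folklore] -/
theorem hasContinuumLimit_of_blockAvg₂_effTiltRateGB (D : FiniteEpsData F G) (𝓜 : GroupAverage G) (ℰ : LoopAverage G)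
    (hMm : ∀ n, Measurable (fun W : Fin (n+1) → G => 𝓜.M W)) (hE : ∀ n, Measurable (fun W : Fin (n+1) → G => ℰ.E W))
    (hD : ∀ K j, D.av K j = BlockAveragingTwoLevel.blockAvg₂ 𝓜 ℰ) (g₀ : ℕ → ℝ) {R : ℝ} {σ w w' : ℕ → ℝ}
    (hσ : Summable σ) (hw : Summable w) (hw' : Summable w')
    (h : CanonicalEffTiltRateGB D (D.avgMeasurable_of_blockAvg₂ 𝓜 ℰ hMm hE hD) g₀ R σ w w') :
    HasContinuumLimit (D.scheme g₀) :=
  hasContinuumLimit_of_canonicalEffTiltRateGB D _ g₀ hσ hw hw' h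

/-! ## §5 Appendix: the law-level currencies of `T4VarianceMatching` §4–§6 along the canonical unit factorisation -/

/-- The scheme's observables are bounded by `1` (`FiniteEpsData.abs_avgObs_le_one`). [folklore] -/
theorem scheme_abs_obs_le_one (D : FiniteEpsData F G) (g₀ : ℕ → ℝ) : ∀ K C U, |(D.scheme g₀).obs K C U| ≤ 1 :=
  fun K C U => D.abs_avgObs_le_one K C U

/-- The unit-lattice TRANSPORT currency (§4 `EffTransportRate`, NOT PRINTED) for the data: `Σ Δ < ∞ ⇒` apex. [folklore] -/
theorem hasContinuumLimit_of_canonicalEffTransportRate (D : FiniteEpsData F G) (hM : D.AvgMeasurable) (g₀ : ℕ → ℝ)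
    {Δ : ℕ → ℝ} (hΔ : Summable Δ) (h : (unitFactorisation D hM g₀).EffTransportRate Δ) :
    HasContinuumLimit (D.scheme g₀) :=
  (unitFactorisation D hM g₀).hasContinuumLimit_of_effTransportRate (scheme_β_nonneg D g₀)
    (scheme_obs_measurable D hM g₀) (scheme_abs_obs_le_one D g₀) hΔ h

/-- The unit-lattice DENSITY (small-field / large-field) currency (§5 `EffDensityRate`, NOT PRINTED) for the data:
`Σ (s + w + w') < ∞ ⇒` apex. [folklore] -/
theorem hasContinuumLimit_of_canonicalEffDensityRate (D : FiniteEpsData F G) (hM : D.AvgMeasurable) (g₀ : ℕ → ℝ)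
    {s w w' : ℕ → ℝ} (hs : Summable s) (hw : Summable w) (hw' : Summable w')
    (h : (unitFactorisation D hM g₀).EffDensityRate s w w') : HasContinuumLimit (D.scheme g₀) :=
  (unitFactorisation D hM g₀).hasContinuumLimit_of_effDensityRate (scheme_β_nonneg D g₀)
    (scheme_obs_measurable D hM g₀) (scheme_abs_obs_le_one D g₀) hs hw hw' h

/-- The unit-lattice SECOND-MOMENT currency (§6 `EffSecondMomentRate`, NOT PRINTED) for the data: `Σ Δ < ∞ ⇒` apex.
[folklore] -/
theorem hasContinuumLimit_of_canonicalEffSecondMomentRate (D : FiniteEpsData F G) (hM : D.AvgMeasurable)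
    (g₀ : ℕ → ℝ) {Δ : ℕ → ℝ} (hΔ : Summable Δ) (h : (unitFactorisation D hM g₀).EffSecondMomentRate Δ) :
    HasContinuumLimit (D.scheme g₀) :=
  (unitFactorisation D hM g₀).hasContinuumLimit_of_effSecondMomentRate (scheme_β_nonneg D g₀)
    (scheme_obs_measurable D hM g₀) hΔ h

/-! ## §6 (v2) The weakest canonical density-level currency, and the LIMITING EFFECTIVE LAW OF THE DATA
(via `T4EffectiveLawLimit`)

`CanonicalDensityChain D hM g₀ δ` (hypothesis shape, NOT PRINTED): the unit-lattice effective laws of the data — the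
push-forwards of the Wilson Gibbs measures of runs `K = 0, 1, 2, …` under `K` averaging steps, read on the unit lattice
through `unitShift` — form an `L¹` density chain: `effLaw (K+1) = g_K · effLaw K`, `g_K ≥ 0` measurable,
`∫ |g_K − 1| d(effLaw K) ≤ δ_K` (`T4EffectiveLawLimit.DensityChain`).  NE7-A / NE7-A′ (§2–§3) and NE7-D along the
canonical factorisation are PRODUCERS (constants `2e^{2R}σ`, `4e^{2R}σ + 2(w + w')`, `s + w + w'`).  With `Σ δ_K < ∞` it
gives, for the data's own scheme and BY NAME: the LIMITING EFFECTIVE UNIT-LATTICE LAW `ν` of the data (total-variation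
limit at the tail rate, `ν ≪ effLaw 0`), the continuum limit of every string identified as `∫ ∏ W_C dν`, the apex
`HasContinuumLimit (D.scheme g₀)`, T4LimitLaw's unique limit law `= (wVec)_* ν`, the carved NE7
`MatchingModConstants 1 l₀ (e^{2l₀} δ) (schemeZ (D.scheme g₀) Cs)` and `GenFunCauchy (D.scheme g₀) l₀`.  Nothing of this is
an input: the chain property for Bałaban's data is NE7 in density currency, NOT PRINTED (header, GAPS G-ne7p3-7). -/

/-- **The weakest canonical density-level two-run currency (hypothesis shape, NOT PRINTED)**: the data's unit-lattice
effective laws form an `L¹` density chain with rates `δ_K`. [folklore] -/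
def CanonicalDensityChain (D : FiniteEpsData F G) (hM : D.AvgMeasurable) (g₀ : ℕ → ℝ) (δ : ℕ → ℝ) : Prop :=
  T4EffectiveLawLimit.DensityChain (unitFactorisation D hM g₀).effLaw δ

/-- [folklore] -/
theorem canonicalDensityChain_iff (D : FiniteEpsData F G) (hM : D.AvgMeasurable) (g₀ : ℕ → ℝ) (δ : ℕ → ℝ) :
    CanonicalDensityChain D hM g₀ δ ↔ T4EffectiveLawLimit.DensityChain (unitFactorisation D hM g₀).effLaw δ :=
  Iff.rfl

/-- **NE7-A (canonical) is a canonical density chain**, `δ_K = 2e^{2R} σ_K`. [folklore] -/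
theorem canonicalDensityChain_of_canonicalEffTiltRate (D : FiniteEpsData F G) (hM : D.AvgMeasurable) (g₀ : ℕ → ℝ)
    {R : ℝ} {σ : ℕ → ℝ} (h : CanonicalEffTiltRate D hM g₀ R σ) :
    CanonicalDensityChain D hM g₀ (fun K => 2 * Real.exp (2 * R) * σ K) :=
  T4EffectiveLawLimit.densityChain_of_effTiltRate (unitFactorisation D hM g₀) (scheme_β_nonneg D g₀) h

/-- **NE7-A′ (canonical) is a canonical density chain**, `δ_K = 4e^{2R} σ_K + 2(w_K + w'_K)`. [folklore] -/
theorem canonicalDensityChain_of_canonicalEffTiltRateGB (D : FiniteEpsData F G) (hM : D.AvgMeasurable) (g₀ : ℕ → ℝ)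
    {R : ℝ} {σ w w' : ℕ → ℝ} (h : CanonicalEffTiltRateGB D hM g₀ R σ w w') :
    CanonicalDensityChain D hM g₀ (fun K => 4 * Real.exp (2 * R) * σ K + 2 * (w K + w' K)) :=
  T4EffectiveLawLimit.densityChain_of_effTiltRateGB (unitFactorisation D hM g₀) (scheme_β_nonneg D g₀) h

/-- **NE7-D along the canonical factorisation is a canonical density chain**, `δ_K = s_K + w_K + w'_K`. [folklore] -/
theorem canonicalDensityChain_of_effDensityRate (D : FiniteEpsData F G) (hM : D.AvgMeasurable) (g₀ : ℕ → ℝ)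
    {s w w' : ℕ → ℝ} (h : (unitFactorisation D hM g₀).EffDensityRate s w w') :
    CanonicalDensityChain D hM g₀ (fun K => s K + w K + w' K) :=
  T4EffectiveLawLimit.densityChain_of_effDensityRate (unitFactorisation D hM g₀) (scheme_β_nonneg D g₀) h

/-- **THE LIMITING EFFECTIVE UNIT-LATTICE LAW OF THE DATA** under a summable canonical density chain: a probability
measure `ν` on unit-lattice gauge fields, `ν ≪ effLaw 0`, with
`|∫ g d(effLaw K) − ∫ g dν| ≤ B · Σ_{j ≥ K} δ_j` for every measurable `|g| ≤ B`. [folklore] -/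
theorem exists_limitLaw_of_canonicalDensityChain (D : FiniteEpsData F G) (hM : D.AvgMeasurable) (g₀ : ℕ → ℝ)
    {δ : ℕ → ℝ} (h : CanonicalDensityChain D hM g₀ δ) (hδ : Summable δ) :
    ∃ ν : Measure (GaugeField (F.P 0) 0 G), IsProbabilityMeasure ν ∧ ν ≪ (unitFactorisation D hM g₀).effLaw 0 ∧
      ∀ (K : ℕ) (B : ℝ) (g : GaugeField (F.P 0) 0 G → ℝ), Measurable g → (∀ u, |g u| ≤ B) →
        |∫ u, g u ∂((unitFactorisation D hM g₀).effLaw K) - ∫ u, g u ∂ν| ≤ B * ∑' j, δ (j + K) :=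
  T4EffectiveLawLimit.exists_limitLaw_of_densityChain (unitFactorisation D hM g₀) (scheme_β_nonneg D g₀) h hδ

/-- **The continuum limit of every string of the data identified as an expectation under the limiting law.**
[folklore] -/
theorem exists_limitLaw_tendsto_expectAt_of_canonicalDensityChain (D : FiniteEpsData F G) (hM : D.AvgMeasurable)
    (g₀ : ℕ → ℝ) {δ : ℕ → ℝ} (h : CanonicalDensityChain D hM g₀ δ) (hδ : Summable δ) :
    ∃ ν : Measure (GaugeField (F.P 0) 0 G), IsProbabilityMeasure ν ∧ ν ≪ (unitFactorisation D hM g₀).effLaw 0 ∧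
      ∀ Cs : List (ULoop F), Filter.Tendsto (fun K => (D.scheme g₀).expectAt K Cs) Filter.atTop
        (nhds (∫ u, T4LimitLaw.monomial Cs ((unitFactorisation D hM g₀).wVec u) ∂ν)) :=
  T4EffectiveLawLimit.exists_limitLaw_tendsto_expectAt (unitFactorisation D hM g₀) (scheme_β_nonneg D g₀)
    (scheme_obs_measurable D hM g₀) h hδ

/-- **Summable canonical density chain ⇒ the apex for the data's scheme.** [folklore] -/
theorem hasContinuumLimit_of_canonicalDensityChain (D : FiniteEpsData F G) (hM : D.AvgMeasurable) (g₀ : ℕ → ℝ)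
    {δ : ℕ → ℝ} (h : CanonicalDensityChain D hM g₀ δ) (hδ : Summable δ) : HasContinuumLimit (D.scheme g₀) :=
  T4EffectiveLawLimit.hasContinuumLimit_of_densityChain (unitFactorisation D hM g₀) (scheme_β_nonneg D g₀)
    (scheme_obs_measurable D hM g₀) h hδ

/-- **Canonical density chain ⇒ the carved NE7 for the data's scheme**, `vol = 1`, remainder `e^{2l₀} δ_K`, constants
`log Z_{K+1}(0) − log Z_K(0)` only. [folklore] -/
theorem matchingModConstants_of_canonicalDensityChain (D : FiniteEpsData F G) (hM : D.AvgMeasurable) (g₀ : ℕ → ℝ)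
    {δ : ℕ → ℝ} (h : CanonicalDensityChain D hM g₀ δ) {l₀ : ℝ} (hl₀ : 0 ≤ l₀) (Cs : List (ULoop F)) :
    T4CauchySum.MatchingModConstants 1 l₀ (fun K => Real.exp (2 * l₀) * δ K)
      (T4GenFunBounds.schemeZ (D.scheme g₀) Cs) :=
  T4EffectiveLawLimit.matchingModConstants_of_densityChain (unitFactorisation D hM g₀) (scheme_β_nonneg D g₀)
    (scheme_obs_measurable D hM g₀) h hl₀ Cs

/-- **Summable canonical density chain ⇒ node U0's input `GenFunCauchy (D.scheme g₀) l₀`.** [folklore] -/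
theorem genFunCauchy_of_canonicalDensityChain (D : FiniteEpsData F G) (hM : D.AvgMeasurable) (g₀ : ℕ → ℝ)
    {δ : ℕ → ℝ} (h : CanonicalDensityChain D hM g₀ δ) (hδ : Summable δ) {l₀ : ℝ} (hl₀ : 0 ≤ l₀) :
    T4Assembly.GenFunCauchy (D.scheme g₀) l₀ :=
  T4EffectiveLawLimit.genFunCauchy_of_densityChain (unitFactorisation D hM g₀) (scheme_β_nonneg D g₀)
    (scheme_obs_measurable D hM g₀) h hδ hl₀

/-- **T4LimitLaw's unique limit law of the data identified**: under a summable canonical density chain the laws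
`law_K` of the clamped loop vector converge to `(wVec)_* ν`, which is THE limit law singled out by
`T4LimitLaw.existsUnique_limitLaw` (`ULoop F` is countable). [folklore] -/
theorem exists_limitLaw_identified_of_canonicalDensityChain (D : FiniteEpsData F G) (hM : D.AvgMeasurable)
    (g₀ : ℕ → ℝ) {δ : ℕ → ℝ} (h : CanonicalDensityChain D hM g₀ δ) (hδ : Summable δ) :
    ∃ (ν : Measure (GaugeField (F.P 0) 0 G)) (_ : IsProbabilityMeasure ν),
      ν ≪ (unitFactorisation D hM g₀).effLaw 0 ∧
      Filter.Tendsto (T4LimitLaw.law (D.scheme g₀) (scheme_β_nonneg D g₀) (scheme_obs_measurable D hM g₀))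
        Filter.atTop (nhds (⟨ν.map (unitFactorisation D hM g₀).wVec,
          Measure.isProbabilityMeasure_map (unitFactorisation D hM g₀).measurable_wVec.aemeasurable⟩ :
            ProbabilityMeasure (T4LimitLaw.Cube (ULoop F)))) ∧
      ∀ ν' : ProbabilityMeasure (T4LimitLaw.Cube (ULoop F)),
        (∀ Cs : List (ULoop F), Filter.Tendsto (fun K => (D.scheme g₀).expectAt K Cs) Filter.atTop
          (nhds (∫ x, T4LimitLaw.monomial Cs x ∂(ν' : Measure (T4LimitLaw.Cube (ULoop F)))))) →
        (ν' : Measure (T4LimitLaw.Cube (ULoop F))) = ν.map (unitFactorisation D hM g₀).wVec :=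
  T4EffectiveLawLimit.exists_limitLaw_identified (unitFactorisation D hM g₀) (scheme_β_nonneg D g₀)
    (scheme_obs_measurable D hM g₀) h hδ

/-- **(0.12)-block-averaged data**: measurability from the kernel; a summable canonical density chain is then the ONLY
hypothesis for the limiting law / the apex. [folklore] -/
theorem hasContinuumLimit_of_blockAvg₂_densityChain (D : FiniteEpsData F G) (𝓜 : GroupAverage G) (ℰ : LoopAverage G)
    (hMm : ∀ n, Measurable (fun W : Fin (n+1) → G => 𝓜.M W)) (hE : ∀ n, Measurable (fun W : Fin (n+1) → G => ℰ.E W))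
    (hD : ∀ K j, D.av K j = BlockAveragingTwoLevel.blockAvg₂ 𝓜 ℰ) (g₀ : ℕ → ℝ) {δ : ℕ → ℝ} (hδ : Summable δ)
    (h : CanonicalDensityChain D (D.avgMeasurable_of_blockAvg₂ 𝓜 ℰ hMm hE hD) g₀ δ) :
    HasContinuumLimit (D.scheme g₀) :=
  hasContinuumLimit_of_canonicalDensityChain D _ g₀ h hδ


/-- **NE7-TV along the canonical factorisation (pv01's `EffTVRate`, the weakest law-level currency) with
`Σ t_K < ∞` ⇒ THE LIMITING EFFECTIVE UNIT-LATTICE LAW OF THE DATA** (tail rate `2 Σ_{j ≥ K} t_j`; here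
`ν ≪ Σ 2^{-(K+1)} effLaw_K`). [folklore] -/
theorem exists_limitLaw_of_canonicalEffTVRate (D : FiniteEpsData F G) (hM : D.AvgMeasurable) (g₀ : ℕ → ℝ)
    {t : ℕ → ℝ} (h : T4MaximalCoupling.EffTVRate (unitFactorisation D hM g₀) t) (ht : Summable t) :
    ∃ ν : Measure (GaugeField (F.P 0) 0 G), IsProbabilityMeasure ν ∧
      ν ≪ T4EffectiveLawLimit.domMeasure (unitFactorisation D hM g₀).effLaw ∧
      ∀ (K : ℕ) (B : ℝ) (g : GaugeField (F.P 0) 0 G → ℝ), Measurable g → (∀ u, |g u| ≤ B) →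
        |∫ u, g u ∂((unitFactorisation D hM g₀).effLaw K) - ∫ u, g u ∂ν| ≤ B * ∑' j, 2 * t (j + K) :=
  T4EffectiveLawLimit.exists_limitLaw_of_effTVRate (unitFactorisation D hM g₀) (scheme_β_nonneg D g₀) h ht

/-- **Canonical NE7-TV with `Σ t_K < ∞` ⇒ the continuum limit of every string of the data identified.** [folklore] -/
theorem exists_limitLaw_tendsto_expectAt_of_canonicalEffTVRate (D : FiniteEpsData F G) (hM : D.AvgMeasurable)
    (g₀ : ℕ → ℝ) {t : ℕ → ℝ} (h : T4MaximalCoupling.EffTVRate (unitFactorisation D hM g₀) t) (ht : Summable t) :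
    ∃ ν : Measure (GaugeField (F.P 0) 0 G), IsProbabilityMeasure ν ∧
      ∀ Cs : List (ULoop F), Filter.Tendsto (fun K => (D.scheme g₀).expectAt K Cs) Filter.atTop
        (nhds (∫ u, T4LimitLaw.monomial Cs ((unitFactorisation D hM g₀).wVec u) ∂ν)) :=
  T4EffectiveLawLimit.exists_limitLaw_tendsto_expectAt_of_effTVRate (unitFactorisation D hM g₀)
    (scheme_β_nonneg D g₀) (scheme_obs_measurable D hM g₀) h ht

/-- **Canonical NE7-TV ⇒ the carved NE7 for the data's scheme** (remainder `e^{2l₀}·2t_K`). [folklore] -/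
theorem matchingModConstants_of_canonicalEffTVRate (D : FiniteEpsData F G) (hM : D.AvgMeasurable) (g₀ : ℕ → ℝ)
    {t : ℕ → ℝ} (h : T4MaximalCoupling.EffTVRate (unitFactorisation D hM g₀) t) {l₀ : ℝ} (hl₀ : 0 ≤ l₀)
    (Cs : List (ULoop F)) :
    T4CauchySum.MatchingModConstants 1 l₀ (fun K => Real.exp (2 * l₀) * (2 * t K))
      (T4GenFunBounds.schemeZ (D.scheme g₀) Cs) :=
  T4EffectiveLawLimit.matchingModConstants_of_effTVRate (unitFactorisation D hM g₀) (scheme_β_nonneg D g₀)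
    (scheme_obs_measurable D hM g₀) h hl₀ Cs

/-- **Canonical NE7-TV with `Σ t_K < ∞` ⇒ node U0's input `GenFunCauchy (D.scheme g₀) l₀`.** [folklore] -/
theorem genFunCauchy_of_canonicalEffTVRate (D : FiniteEpsData F G) (hM : D.AvgMeasurable) (g₀ : ℕ → ℝ)
    {t : ℕ → ℝ} (ht : Summable t) (h : T4MaximalCoupling.EffTVRate (unitFactorisation D hM g₀) t) {l₀ : ℝ}
    (hl₀ : 0 ≤ l₀) : T4Assembly.GenFunCauchy (D.scheme g₀) l₀ :=
  T4EffectiveLawLimit.genFunCauchy_of_effTVRate (unitFactorisation D hM g₀) (scheme_β_nonneg D g₀)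
    (scheme_obs_measurable D hM g₀) ht h hl₀


/-! ## §7 THE continuum law identified (v2): under any summable two-run currency, `T4ContinuumLaw`'s
## `continuumLaw` / `apexContinuumLaw` IS the push-forward `(wVec)_* ν` of the limiting effective unit-lattice law

`T4ContinuumLaw` (imported for this section only) packages "the continuum limit exists and is unique" as ONE Borel
probability law on the loop cube — `continuumLaw S … h` (scheme level), `apexContinuumLaw D hM g₀ h` (the data),
characterised by `IsContinuumLawAt` — on which the OS / Hilbert-space files are built.  Here: for ANY probability measure
`ν` on unit-lattice fields with tail bounds `|∫ g d(effLaw K) − ∫ g dν| ≤ B·a_K`, `a_K → 0` (the conclusions of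
`T4EffectiveLawLimit` §2/§5/§6 and of §6 above), that law is `(wVec)_* ν`; so under a summable canonical density chain
(NE7-A / NE7-A′ / NE7-D along the canonical factorisation) or a summable canonical NE7-TV, THE CONTINUUM LAW OF THE DATA
is the image of a probability law on unit-lattice gauge fields under the unit-scale averaged loop variables.  Nothing
here is an input; the currencies remain NOT PRINTED. [folklore] -/

section ContinuumLawId

open T4ContinuumLaw T4LimitLaw Filter Topology

section SchemeLevel

variable {G' : Type*} {O : Type*} [Countable O] {S : TorusScheme G' O} [MeasurableSpace G'] [GaugeGroup G']
  [RegularGaugeGroup G'] [HaarData G'] {X : Type*} [MeasurableSpace X] (Φ : UnitFactorisation S X)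

/-- **Scheme level: THE continuum law of `T4ContinuumLaw` is `(wVec)_* ν` for ANY tail-limit law `ν`** of the
effective laws of a unit factorisation (countable observable class). [folklore] -/
theorem continuumLaw_eq_map_of_tail (hβ : ∀ K, 0 ≤ S.β K) (hm : ∀ K o, Measurable (S.obs K o))
    {ν : Measure X} [IsProbabilityMeasure ν] {a : ℕ → ℝ} (ha : Tendsto a atTop (𝓝 0))
    (hb : ∀ (K : ℕ) (B : ℝ) (g : X → ℝ), Measurable g → (∀ u, |g u| ≤ B) →
      |∫ u, g u ∂(Φ.effLaw K) - ∫ u, g u ∂ν| ≤ B * a K) (hC : HasContinuumLimit S) :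
    continuumLaw S hβ hm Φ.abs_obs_le_one hC =
      ⟨ν.map Φ.wVec, Measure.isProbabilityMeasure_map Φ.measurable_wVec.aemeasurable⟩ := by
  let νm : ProbabilityMeasure (Cube O) :=
    ⟨ν.map Φ.wVec, Measure.isProbabilityMeasure_map Φ.measurable_wVec.aemeasurable⟩
  have hνm : ∀ os : List O,
      Tendsto (fun K => S.expectAt K os) atTop (𝓝 (∫ x, monomial os x ∂(νm : Measure (Cube O)))) := by
    intro os
    have hcoe : (νm : Measure (Cube O)) = ν.map Φ.wVec := rfl
    rw [hcoe, T4EffectiveLawLimit.integral_monomial_map_wVec Φ ν os]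
    exact T4EffectiveLawLimit.tendsto_expectAt_of_tail Φ hβ hm ha hb os
  exact (eq_continuumLaw_of_tendsto_expectAt S hβ hm Φ.abs_obs_le_one hC hνm).symm

/-- **Scheme level, summable density chain** (NE7-A / NE7-A′ / NE7-D): the limiting effective law `ν ≪ effLaw 0` with
its tail bounds, AND `continuumLaw = (wVec)_* ν`. [folklore] -/
theorem exists_limitLaw_continuumLaw_eq_of_densityChain (hβ : ∀ K, 0 ≤ S.β K) (hm : ∀ K o, Measurable (S.obs K o))
    {δ : ℕ → ℝ} (h : T4EffectiveLawLimit.DensityChain Φ.effLaw δ) (hδ : Summable δ) :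
    ∃ (ν : Measure X) (_ : IsProbabilityMeasure ν), ν ≪ Φ.effLaw 0 ∧
      (∀ (K : ℕ) (B : ℝ) (g : X → ℝ), Measurable g → (∀ u, |g u| ≤ B) →
        |∫ u, g u ∂(Φ.effLaw K) - ∫ u, g u ∂ν| ≤ B * ∑' j, δ (j + K)) ∧
      continuumLaw S hβ hm Φ.abs_obs_le_one (T4EffectiveLawLimit.hasContinuumLimit_of_densityChain Φ hβ hm h hδ) =
        ⟨ν.map Φ.wVec, Measure.isProbabilityMeasure_map Φ.measurable_wVec.aemeasurable⟩ := by
  obtain ⟨ν, hν, hac, hb⟩ := T4EffectiveLawLimit.exists_limitLaw_of_densityChain Φ hβ h hδ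
  exact ⟨ν, hν, hac, hb, continuumLaw_eq_map_of_tail Φ hβ hm (tendsto_sum_nat_add δ) hb _⟩

/-- **Scheme level, summable NE7-TV** (pv01's `EffTVRate`): the limiting effective law (`≪` the dominating mixture) with
its tail bounds, AND `continuumLaw = (wVec)_* ν`. [folklore] -/
theorem exists_limitLaw_continuumLaw_eq_of_effTVRate (hβ : ∀ K, 0 ≤ S.β K) (hm : ∀ K o, Measurable (S.obs K o))
    {t : ℕ → ℝ} (h : T4MaximalCoupling.EffTVRate Φ t) (ht : Summable t) :
    ∃ (ν : Measure X) (_ : IsProbabilityMeasure ν), ν ≪ T4EffectiveLawLimit.domMeasure Φ.effLaw ∧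
      (∀ (K : ℕ) (B : ℝ) (g : X → ℝ), Measurable g → (∀ u, |g u| ≤ B) →
        |∫ u, g u ∂(Φ.effLaw K) - ∫ u, g u ∂ν| ≤ B * ∑' j, 2 * t (j + K)) ∧
      ∀ hC : HasContinuumLimit S, continuumLaw S hβ hm Φ.abs_obs_le_one hC =
        ⟨ν.map Φ.wVec, Measure.isProbabilityMeasure_map Φ.measurable_wVec.aemeasurable⟩ := by
  obtain ⟨ν, hν, hac, hb⟩ := T4EffectiveLawLimit.exists_limitLaw_of_effTVRate Φ hβ h ht
  exact ⟨ν, hν, hac, hb, fun hC => continuumLaw_eq_map_of_tail Φ hβ hm (tendsto_sum_nat_add fun j => 2 * t j) hb hC⟩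

end SchemeLevel

/-- **THE CONTINUUM LAW OF THE DATA is `(wVec)_* ν` for ANY tail-limit law `ν`** of the canonical effective laws. [folklore] -/
theorem apexContinuumLaw_eq_map_of_tail (D : FiniteEpsData F G) (hM : D.AvgMeasurable) (g₀ : ℕ → ℝ)
    {ν : Measure (GaugeField (F.P 0) 0 G)} [IsProbabilityMeasure ν] {a : ℕ → ℝ} (ha : Tendsto a atTop (𝓝 0))
    (hb : ∀ (K : ℕ) (B : ℝ) (g : GaugeField (F.P 0) 0 G → ℝ), Measurable g → (∀ u, |g u| ≤ B) →
      |∫ u, g u ∂((unitFactorisation D hM g₀).effLaw K) - ∫ u, g u ∂ν| ≤ B * a K)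
    (hC : HasContinuumLimit (D.scheme g₀)) :
    apexContinuumLaw D hM g₀ hC =
      ⟨ν.map (unitFactorisation D hM g₀).wVec,
        Measure.isProbabilityMeasure_map (unitFactorisation D hM g₀).measurable_wVec.aemeasurable⟩ :=
  continuumLaw_eq_map_of_tail (unitFactorisation D hM g₀) (scheme_β_nonneg D g₀) (scheme_obs_measurable D hM g₀) ha hb hC

/-- **… and `(wVec)_* ν` satisfies the whole continuum-law package `IsContinuumLawAt`** (full-sequence weak convergence of
the laws of the averaged loop variables, uniqueness along subsequences, string expectations, generating functions). [folklore] -/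
theorem isContinuumLawAt_map_of_tail (D : FiniteEpsData F G) (hM : D.AvgMeasurable) (g₀ : ℕ → ℝ)
    {ν : Measure (GaugeField (F.P 0) 0 G)} [IsProbabilityMeasure ν] {a : ℕ → ℝ} (ha : Tendsto a atTop (𝓝 0))
    (hb : ∀ (K : ℕ) (B : ℝ) (g : GaugeField (F.P 0) 0 G → ℝ), Measurable g → (∀ u, |g u| ≤ B) →
      |∫ u, g u ∂((unitFactorisation D hM g₀).effLaw K) - ∫ u, g u ∂ν| ≤ B * a K) :
    IsContinuumLawAt D hM g₀
      ⟨ν.map (unitFactorisation D hM g₀).wVec,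
        Measure.isProbabilityMeasure_map (unitFactorisation D hM g₀).measurable_wVec.aemeasurable⟩ := by
  have hC : HasContinuumLimit (D.scheme g₀) :=
    T4EffectiveLawLimit.hasContinuumLimit_of_tail (unitFactorisation D hM g₀) (scheme_β_nonneg D g₀)
      (scheme_obs_measurable D hM g₀) ha hb
  rw [← apexContinuumLaw_eq_map_of_tail D hM g₀ ha hb hC]
  exact isContinuumLawAt_apexContinuumLaw D hM g₀ hC

/-- **Summable canonical density chain ⇒ the limiting effective unit-lattice law of the data, `ν ≪ effLaw 0`, whose
image under the averaged loop variables IS THE CONTINUUM LAW OF THE DATA** (`IsContinuumLawAt`). [folklore] -/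
theorem exists_limitLaw_isContinuumLawAt_of_canonicalDensityChain (D : FiniteEpsData F G) (hM : D.AvgMeasurable)
    (g₀ : ℕ → ℝ) {δ : ℕ → ℝ} (h : CanonicalDensityChain D hM g₀ δ) (hδ : Summable δ) :
    ∃ (ν : Measure (GaugeField (F.P 0) 0 G)) (_ : IsProbabilityMeasure ν),
      ν ≪ (unitFactorisation D hM g₀).effLaw 0 ∧
      (∀ (K : ℕ) (B : ℝ) (g : GaugeField (F.P 0) 0 G → ℝ), Measurable g → (∀ u, |g u| ≤ B) →
        |∫ u, g u ∂((unitFactorisation D hM g₀).effLaw K) - ∫ u, g u ∂ν| ≤ B * ∑' j, δ (j + K)) ∧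
      IsContinuumLawAt D hM g₀
        ⟨ν.map (unitFactorisation D hM g₀).wVec,
          Measure.isProbabilityMeasure_map (unitFactorisation D hM g₀).measurable_wVec.aemeasurable⟩ := by
  obtain ⟨ν, hν, hac, hb⟩ := exists_limitLaw_of_canonicalDensityChain D hM g₀ h hδ
  exact ⟨ν, hν, hac, hb, isContinuumLawAt_map_of_tail D hM g₀ (tendsto_sum_nat_add δ) hb⟩

/-- **Summable canonical NE7-TV ⇒ the limiting effective law of the data (`≪` the dominating mixture), whose image under
the averaged loop variables IS THE CONTINUUM LAW OF THE DATA.** [folklore] -/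
theorem exists_limitLaw_isContinuumLawAt_of_canonicalEffTVRate (D : FiniteEpsData F G) (hM : D.AvgMeasurable)
    (g₀ : ℕ → ℝ) {t : ℕ → ℝ} (h : T4MaximalCoupling.EffTVRate (unitFactorisation D hM g₀) t) (ht : Summable t) :
    ∃ (ν : Measure (GaugeField (F.P 0) 0 G)) (_ : IsProbabilityMeasure ν),
      ν ≪ T4EffectiveLawLimit.domMeasure (unitFactorisation D hM g₀).effLaw ∧
      (∀ (K : ℕ) (B : ℝ) (g : GaugeField (F.P 0) 0 G → ℝ), Measurable g → (∀ u, |g u| ≤ B) →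
        |∫ u, g u ∂((unitFactorisation D hM g₀).effLaw K) - ∫ u, g u ∂ν| ≤ B * ∑' j, 2 * t (j + K)) ∧
      IsContinuumLawAt D hM g₀
        ⟨ν.map (unitFactorisation D hM g₀).wVec,
          Measure.isProbabilityMeasure_map (unitFactorisation D hM g₀).measurable_wVec.aemeasurable⟩ := by
  obtain ⟨ν, hν, hac, hb⟩ := exists_limitLaw_of_canonicalEffTVRate D hM g₀ h ht
  exact ⟨ν, hν, hac, hb, isContinuumLawAt_map_of_tail D hM g₀ (tendsto_sum_nat_add fun j => 2 * t j) hb⟩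

/-- **In particular, under the canonical NE7-A (summable `σ`)**: the continuum law of the data is the image of a
probability law `ν ≪ effLaw 0` on unit-lattice gauge fields. [folklore] -/
theorem exists_limitLaw_isContinuumLawAt_of_canonicalEffTiltRate (D : FiniteEpsData F G) (hM : D.AvgMeasurable)
    (g₀ : ℕ → ℝ) {R : ℝ} {σ : ℕ → ℝ} (hσ : Summable σ) (h : CanonicalEffTiltRate D hM g₀ R σ) :
    ∃ (ν : Measure (GaugeField (F.P 0) 0 G)) (_ : IsProbabilityMeasure ν),
      ν ≪ (unitFactorisation D hM g₀).effLaw 0 ∧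
      IsContinuumLawAt D hM g₀
        ⟨ν.map (unitFactorisation D hM g₀).wVec,
          Measure.isProbabilityMeasure_map (unitFactorisation D hM g₀).measurable_wVec.aemeasurable⟩ := by
  obtain ⟨ν, hν, hac, -, hI⟩ := exists_limitLaw_isContinuumLawAt_of_canonicalDensityChain D hM g₀
    (canonicalDensityChain_of_canonicalEffTiltRate D hM g₀ h) (hσ.mul_left _)
  exact ⟨ν, hν, hac, hI⟩

end ContinuumLawId


end Literature.MathematicalPhysics.QuantumFieldTheory.Balaban1983to89.T4CanonicalTiltRate

end
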